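import Summits.SmoothPoincare4.SmoothPoincare4.Theorems.CylinderEntropyImmortalAreaToFloorDoubleLayerMass
import Summits.SmoothPoincare4.SmoothPoincare4.Theorems.CylinderEntropyImmortalAreaToFloorGaussianMassSphere
import Summits.SmoothPoincare4.SmoothPoincare4.Theorems.CylinderEntropyImmortalAreaToFloorKernelChordal
import Summits.SmoothPoincare4.SmoothPoincare4.Theorems.CylinderEntropyCylinderRungTwoFluxIdentity
import Literature.Geometry.Riemannian.SphericalCylinderKernelCertificate
import Literature.Geometry.Riemannian.TiltedSliceEntropy
import HarnessLib

/-!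
# Route `CylinderEntropy`, item `ImmortalAreaToFloor` (stmt-SmoothPoincare4-17197):
# the DENSITY OF A COHERENT DOUBLE LAYER (CASE 0 of the per-ball lemma)

Assembly of the bricks (DT) `…DoubleLayerMass.lean`, (KM) `…GaussianMassSphere.lean`, `…KernelChordal.lean` of the
Allard-free blueprint for the residual `ThinSeq` of the item (evidence `ANALYSIS-prover-17197-c1.md`, §6): if over
every column of a measurable set `P` of the cap `S⁴ ∩ B(p', R)` (`R ≤ 1`) a closed embedded cross-section
`ι : M → N` has two distinct regular fibre points at heights within `w` of the centre height `p₅`, and `P` has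
density `≥ 1 - θ` in every concentric cap `S⁴ ∩ B(p', ρ)`, `ρ ≤ R`, then the typed cylinder density of `ι(M)` at
`(p, τ)` is at least

  `2 · (4πτ)⁻² · e^{-w²/4τ} · (1-θ) · (1-R²/4)² · ∫_{B⁴(0,R)} e^{-(1+R²/3)‖z‖²/4τ} dz`

(`cylDensity_ge_of_coherentDoubleLayer`).  With `R = L₂√τ`, `w, θ` small and `L₂` large the right side is
`2(1 - o(1))` (the Euclidean ball mass of `…GaussianMass.lean`), which is how CASE 0 contradicts `λ_cyl ≤ 2 - δ`.
The normalisations cancel exactly: `μH[4] = c⁻¹ μHE[4]` on every space (landed `hausdorffMeasure_eq_smul_euclidean`),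
`μHE[4](S⁴) = 8π²/3` (tree `TiltedSliceEntropy.euclideanHausdorff_sphere_four`) against the Cheeger–Yau constant
`8π²/3`, and `μHE[4] = volume` on `ℝ⁴`.  Everything is proved; no definition, no named fact.
-/

-- the prescribed namespace `Summit.SmoothPoincare4.SmoothPoincare4.…` repeats `SmoothPoincare4`
set_option linter.dupNamespace false

noncomputable section

open MeasureTheory Set Function Filter Module Real Metric
open scoped Manifold ContDiff ENNReal Topology RealInnerProductSpace NNReal BigOperators

namespace Summit.SmoothPoincare4.SmoothPoincare4.Theorems.CylinderRungTwo.KillingFlux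

open Literature.Geometry.Riemannian
open Literature.Geometry.Lorentzian Literature.Geometry.Lorentzian.PseudoRiemannianMetric
open Literature.Geometry.Riemannian.SphericalCylinderEntropy (truncL truncL_apply cylKernel cylDensity cylKernel_eq
  hausdorffMeasure_sphere_four_pos hausdorffMeasure_sphere_four_lt_top)
open Summit.SmoothPoincare4.SmoothPoincare4.Theorems.GaussianMass

variable {M : Type} [TopologicalSpace M] [ChartedSpace (EuclideanSpace ℝ (Fin 4)) M] [IsManifold (𝓡 4) ∞ M]
  [CompactSpace M] [MeasurableSpace M] [BorelSpace M] [SecondCountableTopology M] [Nonempty M]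

/-- **The density of a coherent double layer** (CASE 0 of the per-ball lemma of the Allard-free blueprint). See the
module docstring. Hypotheses: `ι` a closed smooth embedding into `N` with continuous unit normal `ν` tangent to `N`;
centre `p ∈ N`, scale `τ > 0`, cap radius `0 < R ≤ 1`, height window `w ≥ 0`; `P` a measurable set of columns
inside the cap `S⁴ ∩ B(truncL p, R)` over each of which there are two distinct regular fibre points at heights within
`w` of `p₅`, with density `≥ 1-θ` in every concentric cap of radius `≤ R`. Conclusion:
`ofReal 2 · ofReal (4πτ)⁻² · ofReal e^{-w²/4τ} · ofReal (1-θ) · ofReal (1-R²/4)² · ∫⁻_{B⁴(0,R)} e^{-(1+R²/3)‖z‖²/(4τ)} dz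
 ≤ cylDensity (range ι) p τ`. [cite: Federer1969, 3.2.3] [cite: Davies1989, Thm 5.6.1] -/
theorem cylDensity_ge_of_coherentDoubleLayer {ι ν : M → (EuclideanSpace ℝ (Fin 6))}
    (hι : Manifold.IsSmoothEmbedding (𝓡 4) (𝓡 6) ∞ ι)
    (hιN : ∀ x, ∑ i : Fin 5, ι x (Fin.castSucc i) ^ 2 = 1)
    (hνc : Continuous ν) (hνn : (euclideanMetric (EuclideanSpace ℝ (Fin 6))).IsUnitNormal (𝓡 4) ι ν 1)
    (hνt : ∀ x, ∑ i : Fin 5, ν x (Fin.castSucc i) * ι x (Fin.castSucc i) = 0)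
    {p : EuclideanSpace ℝ (Fin 6)} (hp : ∑ i : Fin 5, p (Fin.castSucc i) ^ 2 = 1) {τ : ℝ} (hτ : 0 < τ)
    {R w θ : ℝ} (hR : 0 < R) (hR1 : R ≤ 1) (hw : 0 ≤ w)
    {P : Set (EuclideanSpace ℝ (Fin 5))} (hPm : MeasurableSet P)
    (hPcap : P ⊆ sphere (0 : EuclideanSpace ℝ (Fin 5)) 1 ∩ ball (truncL p) R)
    (hlayer : ∀ q ∈ P, ∃ x₁ x₂ : M, x₁ ≠ x₂ ∧ truncL (ι x₁) = q ∧ truncL (ι x₂) = q ∧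
      ν x₁ 5 ≠ 0 ∧ ν x₂ 5 ≠ 0 ∧ |ι x₁ 5 - p 5| ≤ w ∧ |ι x₂ 5 - p 5| ≤ w)
    (hdense : ∀ ρ : ℝ, 0 < ρ → ρ ≤ R →
      ENNReal.ofReal (1 - θ) * μH[4] (sphere (0 : EuclideanSpace ℝ (Fin 5)) 1 ∩ ball (truncL p) ρ) ≤
        μH[4] (P ∩ (sphere (0 : EuclideanSpace ℝ (Fin 5)) 1 ∩ ball (truncL p) ρ))) :
    ENNReal.ofReal 2 * ENNReal.ofReal (((4 * π * τ) ^ 2)⁻¹) * ENNReal.ofReal (exp (-w ^ 2 / (4 * τ))) *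
        ENNReal.ofReal (1 - θ) * ENNReal.ofReal ((1 - R ^ 2 / 4) ^ 2) *
          ∫⁻ z in ball (0 : EuclideanSpace ℝ (Fin 4)) R,
            ENNReal.ofReal (exp (-((1 + R ^ 2 / 3) / (4 * τ)) * ‖z‖ ^ 2)) ≤
      cylDensity (Set.range ι) p τ := by
  classical
  -- notation and constants
  set x' : EuclideanSpace ℝ (Fin 5) := truncL p with hx'
  have hx1 : ‖x'‖ = 1 := by
    rw [hx', EuclideanSpace.norm_eq, Real.sqrt_eq_one]
    simpa [truncL_apply, Real.norm_eq_abs, sq_abs] using hp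
  set b : ℝ := (1 + R ^ 2 / 3) / (4 * τ) with hb
  have hbpos : 0 < b := by rw [hb]; positivity
  set c₀ : ℝ := (8 * π ^ 2 / 3) * ((4 * π * τ) ^ 2)⁻¹ with hc₀
  have hc₀pos : 0 < c₀ := by rw [hc₀]; positivity
  set ew : ℝ := exp (-w ^ 2 / (4 * τ)) with hew
  set V : ℝ≥0∞ := μH[4] (sphere (0 : EuclideanSpace ℝ (Fin 5)) 1) with hV
  have hV0 : V ≠ 0 := hausdorffMeasure_sphere_four_pos.ne'
  have hVtop : V ≠ ⊤ := hausdorffMeasure_sphere_four_lt_top.ne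
  -- the Haar factor `c` with `μH[4] = c⁻¹ μHE[4]` on every space, `c ≠ 0`
  set c : ℝ≥0 := Measure.addHaarScalarFactor (volume : Measure (EuclideanSpace ℝ (Fin 4)))
    (μH[(4 : ℕ)] : Measure (EuclideanSpace ℝ (Fin 4))) with hc
  have hc0 : (c : ℝ≥0∞) ≠ 0 := by
    rw [hc]; exact_mod_cast Measure.addHaarScalarFactor_volume_hausdorffMeasure_ne_zero 4
  have hctop : (c : ℝ≥0∞) ≠ ⊤ := ENNReal.coe_ne_top
  have hH6 : (μH[4] : Measure (EuclideanSpace ℝ (Fin 6))) = (c : ℝ≥0∞)⁻¹ • (μHE[4] : Measure (EuclideanSpace ℝ (Fin 6))) :=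
    hausdorffMeasure_eq_smul_euclidean
  have hH5 : (μH[4] : Measure (EuclideanSpace ℝ (Fin 5))) = (c : ℝ≥0∞)⁻¹ • (μHE[4] : Measure (EuclideanSpace ℝ (Fin 5))) :=
    hausdorffMeasure_eq_smul_euclidean
  have hH4 : (μH[4] : Measure (EuclideanSpace ℝ (Fin 4))) = (c : ℝ≥0∞)⁻¹ • (volume : Measure (EuclideanSpace ℝ (Fin 4))) := by
    rw [hausdorffMeasure_eq_smul_euclidean, EuclideanSpace.euclideanHausdorffMeasure_eq_volume]
  -- `V = c⁻¹ (8π²/3)`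
  have hVeq : V = (c : ℝ≥0∞)⁻¹ * ENNReal.ofReal (8 * π ^ 2 / 3) := by
    rw [hV, hH5, Measure.smul_apply, smul_eq_mul, TiltedSliceEntropy.euclideanHausdorff_sphere_four]
  -- the weights
  set K : EuclideanSpace ℝ (Fin 6) → ℝ := fun z => max (cylKernel p τ z) 0 with hK
  have hKm : Measurable K := (SphericalCylinderConformal.measurable_cylKernel p hτ).max measurable_const
  have hK0 : ∀ z, 0 ≤ K z := fun z => le_max_right _ _
  set m : EuclideanSpace ℝ (Fin 5) → ℝ := fun q => c₀ * ew * exp (-b * ‖q - x'‖ ^ 2) with hm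
  have hmm : Measurable m := by
    refine Measurable.const_mul ?_ _
    exact (continuous_exp.comp (continuous_const.mul ((continuous_id.sub continuous_const).norm.pow 2))).measurable
  have hm0 : ∀ q, 0 ≤ m q := fun q => by rw [hm]; positivity
  -- the two fibre points carry `K ≥ m`
  have hlayer' : ∀ q ∈ P, ∃ x₁ x₂ : M, x₁ ≠ x₂ ∧ truncL (ι x₁) = q ∧ truncL (ι x₂) = q ∧
      ν x₁ 5 ≠ 0 ∧ ν x₂ 5 ≠ 0 ∧ m q ≤ K (ι x₁) ∧ m q ≤ K (ι x₂) := by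
    intro q hq
    obtain ⟨x₁, x₂, hne, h1, h2, hν1, hν2, hw1, hw2⟩ := hlayer q hq
    have hqS : ‖q‖ = 1 := by simpa using (hPcap hq).1
    have hqR : ‖q - x'‖ ≤ R := by
      have h := (hPcap hq).2
      rw [mem_ball, dist_eq_norm] at h
      exact h.le
    -- the kernel at a fibre point over `q`
    have hfib : ∀ x : M, truncL (ι x) = q → |ι x 5 - p 5| ≤ w → m q ≤ K (ι x) := by
      intro x hxq hxw
      have hsum : (∑ i : Fin 5, ι x (Fin.castSucc i) * p (Fin.castSucc i)) = ∑ i : Fin 5, q i * x' i := by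
        refine Finset.sum_congr rfl fun i _ => ?_
        rw [← hxq, truncL_apply, hx', truncL_apply]
      have hzon := gaussian_chordal_le_zonal hx1 hqS hqR hR1 hτ
      have hvert : ew ≤ exp (-((ι x 5 - p 5) ^ 2) / (4 * τ)) := by
        rw [hew, exp_le_exp, neg_div, neg_div, neg_le_neg_iff]
        refine div_le_div_of_nonneg_right ?_ (by positivity)
        have := abs_le.1 hxw
        nlinarith [abs_nonneg (ι x 5 - p 5), sq_abs (ι x 5 - p 5)]
      have hK' : cylKernel p τ (ι x) ≤ K (ι x) := le_max_left _ _
      refine le_trans ?_ hK'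
      rw [cylKernel_eq, hsum, hm]
      have e1 : -b * ‖q - x'‖ ^ 2 = -((1 + R ^ 2 / 3) * ‖q - x'‖ ^ 2) / (4 * τ) := by
        rw [hb]; field_simp
      simp only []
      rw [e1, mul_assoc, mul_comm ew, ← mul_assoc]
      exact mul_le_mul hzon hvert (by positivity)
        ((SphericalZonalKernelSeries.zonal_nonneg hτ _ (abs_le.1 (by
          rw [← hsum]; exact SphericalCylinderEntropy.abs_sum_mul_le_one (hιN x) hp))))
    exact ⟨x₁, x₂, hne, h1, h2, hν1, hν2, hfib x₁ h1 hw1, hfib x₂ h2 hw2⟩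
  -- (DT) the double layer mass
  have hDT := two_mul_lintegral_le_lintegral_range_of_doubleLayer hι hιN hνc hνn hνt hKm hK0 hmm hm0 hPm hlayer'
  -- `∫ ofReal K = ∫ ofReal cylKernel`
  have hKint : ∫⁻ z in Set.range ι, ENNReal.ofReal (K z) ∂(μHE[4] : Measure (EuclideanSpace ℝ (Fin 6))) =
      ∫⁻ z in Set.range ι, ENNReal.ofReal (cylKernel p τ z) ∂(μHE[4] : Measure (EuclideanSpace ℝ (Fin 6))) :=
    lintegral_congr fun z => by
      rcases le_total (cylKernel p τ z) 0 with h | h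
      · simp only [hK]; rw [max_eq_right h, ENNReal.ofReal_zero, ENNReal.ofReal_of_nonpos h]
      · simp only [hK]; rw [max_eq_left h]
  -- `∫_P ofReal m = ofReal (c₀ ew) * ∫_P ofReal e^{-b‖q-x'‖²}`
  have hmint : ∫⁻ q in P, ENNReal.ofReal (m q) ∂(μHE[4] : Measure (EuclideanSpace ℝ (Fin 5))) =
      ENNReal.ofReal (c₀ * ew) *
        ∫⁻ q in P, ENNReal.ofReal (exp (-b * ‖q - x'‖ ^ 2)) ∂(μHE[4] : Measure (EuclideanSpace ℝ (Fin 5))) := by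
    have hfm : Measurable fun q : EuclideanSpace ℝ (Fin 5) => ENNReal.ofReal (exp (-b * ‖q - x'‖ ^ 2)) :=
      (continuous_exp.comp (continuous_const.mul
        ((continuous_id.sub continuous_const).norm.pow 2))).measurable.ennreal_ofReal
    rw [← lintegral_const_mul (ENNReal.ofReal (c₀ * ew)) hfm]
    refine lintegral_congr fun q => ?_
    rw [hm, ← ENNReal.ofReal_mul (by positivity)]
  -- (KM) the Gaussian mass of `P` against the flat disc, in `μH[4]`
  have hKM : ENNReal.ofReal (1 - θ) * ENNReal.ofReal ((1 - R ^ 2 / 4) ^ 2) *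
        ∫⁻ z in ball (0 : EuclideanSpace ℝ (Fin 4)) R, ENNReal.ofReal (exp (-b * ‖z‖ ^ 2)) ∂μH[4] ≤
      ∫⁻ q in P, ENNReal.ofReal (exp (-b * ‖q - x'‖ ^ 2)) ∂(μH[4] : Measure (EuclideanSpace ℝ (Fin 5))) := by
    have hR2 : R ^ 2 < 2 := by nlinarith
    have h1 := mul_lintegral_ball_le_lintegral_cap hx1 hR hR2 hbpos
    have h2 := mul_lintegral_cap_le_lintegral_inter_cap (x := x') (θ := θ) hR hbpos hdense
    have hPeq : P ∩ (sphere (0 : EuclideanSpace ℝ (Fin 5)) 1 ∩ ball x' R) = P :=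
      inter_eq_left.2 hPcap
    rw [hPeq] at h2
    calc ENNReal.ofReal (1 - θ) * ENNReal.ofReal ((1 - R ^ 2 / 4) ^ 2) *
          ∫⁻ z in ball (0 : EuclideanSpace ℝ (Fin 4)) R, ENNReal.ofReal (exp (-b * ‖z‖ ^ 2)) ∂μH[4]
        = ENNReal.ofReal (1 - θ) * (ENNReal.ofReal ((1 - R ^ 2 / 4) ^ 2) *
          ∫⁻ z in ball (0 : EuclideanSpace ℝ (Fin 4)) R, ENNReal.ofReal (exp (-b * ‖z‖ ^ 2)) ∂μH[4]) := by ring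
      _ ≤ ENNReal.ofReal (1 - θ) *
          ∫⁻ y in sphere (0 : EuclideanSpace ℝ (Fin 5)) 1 ∩ ball x' R,
            ENNReal.ofReal (exp (-b * ‖y - x'‖ ^ 2)) ∂μH[4] := by gcongr
      _ ≤ _ := h2
  -- the flat disc integral in `volume`
  have hdisc : ∫⁻ z in ball (0 : EuclideanSpace ℝ (Fin 4)) R, ENNReal.ofReal (exp (-b * ‖z‖ ^ 2)) ∂μH[4] =
      (c : ℝ≥0∞)⁻¹ * ∫⁻ z in ball (0 : EuclideanSpace ℝ (Fin 4)) R, ENNReal.ofReal (exp (-b * ‖z‖ ^ 2)) ∂volume := by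
    rw [hH4, Measure.restrict_smul, lintegral_smul_measure, smul_eq_mul]
  -- `∫_P … dμHE = c ∫_P … dμH`
  have hPconv : ∫⁻ q in P, ENNReal.ofReal (exp (-b * ‖q - x'‖ ^ 2)) ∂(μHE[4] : Measure (EuclideanSpace ℝ (Fin 5))) =
      (c : ℝ≥0∞) * ∫⁻ q in P, ENNReal.ofReal (exp (-b * ‖q - x'‖ ^ 2)) ∂(μH[4] : Measure (EuclideanSpace ℝ (Fin 5))) := by
    rw [hH5, Measure.restrict_smul, lintegral_smul_measure, smul_eq_mul, ← mul_assoc,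
      ENNReal.mul_inv_cancel hc0 hctop, one_mul]
  -- the density in `μHE`
  have hdens : cylDensity (Set.range ι) p τ =
      V⁻¹ * ((c : ℝ≥0∞)⁻¹ * ∫⁻ z in Set.range ι, ENNReal.ofReal (cylKernel p τ z)
        ∂(μHE[4] : Measure (EuclideanSpace ℝ (Fin 6)))) := by
    simp only [cylDensity, hV]
    rw [hH6, Measure.restrict_smul, lintegral_smul_measure, smul_eq_mul]
  -- assemble
  rw [hdens, hVeq, ENNReal.mul_inv (Or.inl (ENNReal.inv_ne_zero.2 hctop)) (Or.inl (ENNReal.inv_ne_top.2 hc0)),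
    inv_inv]
  have hkey : ENNReal.ofReal 2 * (ENNReal.ofReal (c₀ * ew) * ((c : ℝ≥0∞) *
      (ENNReal.ofReal (1 - θ) * ENNReal.ofReal ((1 - R ^ 2 / 4) ^ 2) *
        ((c : ℝ≥0∞)⁻¹ * ∫⁻ z in ball (0 : EuclideanSpace ℝ (Fin 4)) R,
          ENNReal.ofReal (exp (-b * ‖z‖ ^ 2)) ∂volume)))) ≤
      ∫⁻ z in Set.range ι, ENNReal.ofReal (cylKernel p τ z) ∂(μHE[4] : Measure (EuclideanSpace ℝ (Fin 6))) := by
    rw [← hdisc]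
    calc ENNReal.ofReal 2 * (ENNReal.ofReal (c₀ * ew) * ((c : ℝ≥0∞) *
          (ENNReal.ofReal (1 - θ) * ENNReal.ofReal ((1 - R ^ 2 / 4) ^ 2) *
            ∫⁻ z in ball (0 : EuclideanSpace ℝ (Fin 4)) R, ENNReal.ofReal (exp (-b * ‖z‖ ^ 2)) ∂μH[4])))
        ≤ ENNReal.ofReal 2 * (ENNReal.ofReal (c₀ * ew) * ((c : ℝ≥0∞) *
            ∫⁻ q in P, ENNReal.ofReal (exp (-b * ‖q - x'‖ ^ 2)) ∂(μH[4] : Measure (EuclideanSpace ℝ (Fin 5))))) := by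
          gcongr
      _ = 2 * ∫⁻ q in P, ENNReal.ofReal (m q) ∂(μHE[4] : Measure (EuclideanSpace ℝ (Fin 5))) := by
          rw [hmint, hPconv, ENNReal.ofReal_ofNat]
      _ ≤ _ := by rw [← hKint]; exact hDT
  -- constants: `(c (8π²/3)⁻¹) (c⁻¹ Y) = (8π²/3)⁻¹ Y` and `(8π²/3)⁻¹ · 2 · (c₀ ew) · (c A c⁻¹ X) = 2 (4πτ)⁻² ew A X`
  have h83 : ENNReal.ofReal (8 * π ^ 2 / 3) ≠ 0 := by
    rw [ne_eq, ENNReal.ofReal_eq_zero, not_le]; positivity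
  have h83t : ENNReal.ofReal (8 * π ^ 2 / 3) ≠ ⊤ := ENNReal.ofReal_ne_top
  set Y := ∫⁻ z in Set.range ι, ENNReal.ofReal (cylKernel p τ z) ∂(μHE[4] : Measure (EuclideanSpace ℝ (Fin 6)))
    with hY
  set X := ∫⁻ z in ball (0 : EuclideanSpace ℝ (Fin 4)) R, ENNReal.ofReal (exp (-b * ‖z‖ ^ 2)) ∂volume with hX
  set A := ENNReal.ofReal (1 - θ) * ENNReal.ofReal ((1 - R ^ 2 / 4) ^ 2) with hA
  have hrhs : (c : ℝ≥0∞) * (ENNReal.ofReal (8 * π ^ 2 / 3))⁻¹ * ((c : ℝ≥0∞)⁻¹ * Y) =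
      (ENNReal.ofReal (8 * π ^ 2 / 3))⁻¹ * Y := by
    rw [show (c : ℝ≥0∞) * (ENNReal.ofReal (8 * π ^ 2 / 3))⁻¹ * ((c : ℝ≥0∞)⁻¹ * Y) =
        ((c : ℝ≥0∞) * (c : ℝ≥0∞)⁻¹) * ((ENNReal.ofReal (8 * π ^ 2 / 3))⁻¹ * Y) by ring,
      ENNReal.mul_inv_cancel hc0 hctop, one_mul]
  rw [hrhs]
  have hcancel : (c : ℝ≥0∞) * (A * ((c : ℝ≥0∞)⁻¹ * X)) = A * X := by
    rw [mul_left_comm, ← mul_assoc (c : ℝ≥0∞), ENNReal.mul_inv_cancel hc0 hctop, one_mul]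
  rw [hcancel] at hkey
  have e1 : ENNReal.ofReal (c₀ * ew) =
      ENNReal.ofReal (8 * π ^ 2 / 3) * ENNReal.ofReal (((4 * π * τ) ^ 2)⁻¹) * ENNReal.ofReal ew := by
    rw [hc₀, ENNReal.ofReal_mul (by positivity), ENNReal.ofReal_mul (by positivity)]
  have hlhs : ENNReal.ofReal 2 * ENNReal.ofReal (((4 * π * τ) ^ 2)⁻¹) * ENNReal.ofReal ew *
        ENNReal.ofReal (1 - θ) * ENNReal.ofReal ((1 - R ^ 2 / 4) ^ 2) * X =
      (ENNReal.ofReal (8 * π ^ 2 / 3))⁻¹ * (ENNReal.ofReal 2 * (ENNReal.ofReal (c₀ * ew) * (A * X))) := by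
    rw [e1, hA,
      show (ENNReal.ofReal (8 * π ^ 2 / 3))⁻¹ * (ENNReal.ofReal 2 *
          (ENNReal.ofReal (8 * π ^ 2 / 3) * ENNReal.ofReal (((4 * π * τ) ^ 2)⁻¹) * ENNReal.ofReal ew *
            (ENNReal.ofReal (1 - θ) * ENNReal.ofReal ((1 - R ^ 2 / 4) ^ 2) * X))) =
        ((ENNReal.ofReal (8 * π ^ 2 / 3))⁻¹ * ENNReal.ofReal (8 * π ^ 2 / 3)) *
          (ENNReal.ofReal 2 * ENNReal.ofReal (((4 * π * τ) ^ 2)⁻¹) * ENNReal.ofReal ew *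
            ENNReal.ofReal (1 - θ) * ENNReal.ofReal ((1 - R ^ 2 / 4) ^ 2) * X) by ring,
      ENNReal.inv_mul_cancel h83 h83t, one_mul]
  rw [hlhs]
  gcongr

end Summit.SmoothPoincare4.SmoothPoincare4.Theorems.CylinderRungTwo.KillingFlux

end
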